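import Summits.BirchSwinnertonDyer.BirchSwinnertonDyer.Theorems.KatoDescentTamePotSupersingularTameLowerFouquetRoadCitedSurj
import Literature.NumberTheory.EllipticCurves.Fouquet2025.OrdinaryCongruenceRankZeroBSDSigma
import HarnessLib

/-!
# Route `KatoDescentTamePotSupersingular` (rung K8, sub-rung B4 (t′), cell `bsd-potss`): the Fouquet ordinary-seed road to
# L₀ (items 19981 / 19618) with Σ = primes of `p·N_W·N_G` — level-RAISING seeds allowed (a `--supports … --as helper`
# file; seat bsd-potss-k8t-c2, generation 5)

The sibling roads (p446605 / p448267) run over the cite-level fact p446173, whose `Σ` is the set of primes of `p N_W`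
(strict level compatibility: every bad prime `≠ p` of the seed divides `N_W`). The seat's D-AUDIT census of the cell
`L_{II*,5}` (HOME/k8t-c2/D-AUDIT-L2star5-rows-k8t-c2-g5.tsv; Cremona ecdata recomputation) finds 366 rows with a certified
good-ordinary partner, of which 99 carry ONLY level-raising partners (an extra Steinberg prime `q ∤ N_W` of `G` at
which `ρ̄` is unramified) — every other binder met. Fouquet's theorem allows any finite `Σ ⊇ Σ(ρ̄) ∪ {p}`; the Σ-enlarged
cite-level fact `Fouquet2025.padicValRat_bsd_rank_zero_of_ordinaryCongruence_sigma` (p449673; Ass. 3.4 on the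
unramified Steinberg primes of BOTH curves, no level binder) is consumed here exactly as the sibling: bridge ⇒ `BSD(W,p)`
⇒ `MissingPPartAt` ⇒ `MissingLowerBoundAt`, and the class forms with the seed displayed by
`GoodOrd G p ∧ Surj G p ∧ Ram G p ∧ IsCongruentModP p W G ∧ FouquetEligibleAt p G` (Irr / tower-onto derived by Serre's
lemma as in p448267). Census: 267 + 99 = 366 of the 429 rows of `L_{II*,5}` (70 of its 85 content rows). Conditional on
the cite-level fact + GZK + modularity; nothing credited; the items are NOT closed; BSD is not proved by any of this.

References: [Fouquet2025EquivariantTNC] Thm 4.1, Thm 1.7 (2), Ass. 3.4 (pp. 22–23); [SkinnerUrban2014] Thm 3.6.9 (p. 45);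
[SerreAbelianLadic1968] Ch. IV §3.4 Lemma 3; [Miller2011LMS] Def. 1.1.
-/

set_option autoImplicit false
-- sibling precedent (`KatoDescentTamePotSupersingularAssembly.lean`): the directory name repeats the summit name
set_option linter.dupNamespace false

noncomputable section

open scoped Classical

namespace Summit.BirchSwinnertonDyer.BirchSwinnertonDyer.Theorems

open WeierstrassCurve Literature.NumberTheory.EllipticCurves
  Literature.NumberTheory.EllipticCurves.ModularForms
  Literature.NumberTheory.EllipticCurves.Rank1Residual
  Literature.NumberTheory.EllipticCurves.Rank1Residual.Typed
  Summit.BirchSwinnertonDyer.Rank1Residual.Additive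
  Summit.BirchSwinnertonDyer.Rank1Residual
  Summit.BirchSwinnertonDyer.BirchSwinnertonDyer.Theses.KatoDescentTamePotSupersingular

/-- **Bridge (definitional), Σ = primes(p N_W N_G)**: on an additive row `W` at `p ≥ 5` with `ρ̄` onto,
`FouquetGenericAt p W`, `FouquetEligibleAt p W`, and a congruent good-ordinary seed `G` with `ρ̄_{G,p}` onto, a ramified
multiplicative prime and `FouquetEligibleAt p G` (Ass. 3.4 at its unramified Steinberg primes), `L(W,1) ≠ 0` and `Ш(W)`
finite, the Σ-enlarged fact gives the print shape `PPartRankZero W p`. Conditional; nothing credited.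
[cite: Fouquet2025EquivariantTNC, Thm 4.1 and Thm 1.7 (2)] [cite: SkinnerUrban2014, Thm 3.6.9 (p. 45)]
[cite: SerreAbelianLadic1968, Ch. IV §3.4 Lemma 3] -/
theorem pPartRankZero_of_fouquetOrdinaryCongruenceSigma
    (hF : Fouquet2025.padicValRat_bsd_rank_zero_of_ordinaryCongruence_sigma)
    (W G : WeierstrassCurve ℚ) [W.IsElliptic] [W.IsGloballyMinimal] [G.IsElliptic] [G.IsGloballyMinimal]
    (p : ℕ) [Fact p.Prime] (hp : 5 ≤ p) (hadd : Addv W p) (hsurj : Surj W p) (hgen : FouquetGenericAt p W)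
    (helig : FouquetEligibleAt p W) (hord : GoodOrd G p) (hsurjG : Surj G p) (hramG : Ram G p)
    (hcong : IsCongruentModP p W G) (heligG : FouquetEligibleAt p G) (hL : W.entireLFunction 1 ≠ 0)
    (hfin : Finite W.sha) : PPartRankZero W p :=
  hF W G p hp hadd.1 hadd.2 hsurj hgen helig hord.1 hord.2
    (hasIrreducibleModPGaloisRep_of_hasSurjectiveModNGaloisRep G p hsurjG) hramG
    (serre_hasSurjectiveModNGaloisRep_pow_holds G p hp hsurjG) hcong heligG hL hfin

/-- **`MissingPPartAt W p` (both halves) on an additive rank-`0` row at `p ≥ 5` with a congruent good-ordinary seed,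
Σ = primes(p N_W N_G)** — from the Σ-enlarged fact + modularity + GZK via `bsdp_of_pPartRankZero`. Conditional.
[cite: Fouquet2025EquivariantTNC, Thm 1.7 (2) (p. 7)] [cite: Miller2011LMS, Def. 1.1] -/
theorem missingPPartAt_rankZero_of_fouquetOrdinaryCongruenceSigma
    (hF : Fouquet2025.padicValRat_bsd_rank_zero_of_ordinaryCongruence_sigma) (hmod : hasEntireLFunction_rat)
    (hGZK : rank_eq_analyticRank_of_analyticRank_le_one)
    (W G : WeierstrassCurve ℚ) [W.IsElliptic] [W.IsGloballyMinimal] [G.IsElliptic] [G.IsGloballyMinimal]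
    (p : ℕ) [Fact p.Prime] (hp : 5 ≤ p) (hr : W.analyticRank = 0) (hadd : Addv W p) (hsurj : Surj W p)
    (hgen : FouquetGenericAt p W) (helig : FouquetEligibleAt p W) (hord : GoodOrd G p) (hsurjG : Surj G p)
    (hramG : Ram G p) (hcong : IsCongruentModP p W G) (heligG : FouquetEligibleAt p G) : MissingPPartAt W p := by
  have hfin : Finite W.sha := (hGZK W (by omega)).2
  have hL : W.entireLFunction 1 ≠ 0 := by
    rw [← W.leadingLCoeff_eq_of_analyticRank_eq_zero hr]
    exact W.leadingLCoeff_ne_zero_holds (hmod W)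
  exact missingPPartAt_of_bsdp W p
    (bsdp_of_pPartRankZero W p hmod hGZK hr
      (pPartRankZero_of_fouquetOrdinaryCongruenceSigma hF W G p hp hadd hsurj hgen helig hord hsurjG hramG hcong
        heligG hL hfin))

/-- **L₀ on the (t′) Fouquet-seed rows, Σ = primes(p N_W N_G)** — class form with the seed displayed by
`GoodOrd ∧ Surj ∧ Ram ∧ congruence ∧ FouquetEligibleAt p G` (level-raising seeds allowed); hypotheses = the
Σ-enlarged cite-level fact + GZK + modularity. Conditional; nothing credited; the items are NOT closed.
[cite: Fouquet2025EquivariantTNC, Thm 4.1 and Thm 1.7 (2), Ass. 3.4 (pp. 22–23)] [cite: SkinnerUrban2014, Thm 3.6.9 (p. 45)]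
[cite: Miller2011LMS, Def. 1.1] -/
theorem tameLowerHalf_fouquetSeedRows_of_sigmaFact
    (hF : Fouquet2025.padicValRat_bsd_rank_zero_of_ordinaryCongruence_sigma)
    (hGZK : rank_eq_analyticRank_of_analyticRank_le_one) (hmod : hasEntireLFunction_rat) :
    ∀ (W : WeierstrassCurve ℚ) [W.IsElliptic] [W.IsGloballyMinimal] (p : ℕ) [Fact p.Prime],
      W.analyticRank = 0 → 5 ≤ p → Addv W p → SubTprime W p → Surj W p → FouquetGenericAt p W →
      FouquetEligibleAt p W →
      (∃ (G : WeierstrassCurve ℚ) (_ : G.IsElliptic) (_ : G.IsGloballyMinimal),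
        GoodOrd G p ∧ Surj G p ∧ Ram G p ∧ IsCongruentModP p W G ∧ FouquetEligibleAt p G) →
      MissingLowerBoundAt W p := by
  intro W _ _ p _ hr hp hadd _ hsurj hgen helig hseed
  obtain ⟨G, hGe, hGm, hord, hsurjG, hramG, hcong, heligG⟩ := hseed
  exact (lower_and_upper_of_missingPPartAt W p
    (missingPPartAt_rankZero_of_fouquetOrdinaryCongruenceSigma hF hmod hGZK W G p hp hr hadd hsurj hgen helig hord
      hsurjG hramG hcong heligG)).1

/-- **Both halves on the same rows, Σ = primes(p N_W N_G).** Conditional; nothing credited.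
[cite: Fouquet2025EquivariantTNC, Thm 1.7 (2) (p. 7)] [cite: Miller2011LMS, Def. 1.1] -/
theorem tameMissingPPartAt_fouquetSeedRows_of_sigmaFact
    (hF : Fouquet2025.padicValRat_bsd_rank_zero_of_ordinaryCongruence_sigma)
    (hGZK : rank_eq_analyticRank_of_analyticRank_le_one) (hmod : hasEntireLFunction_rat) :
    ∀ (W : WeierstrassCurve ℚ) [W.IsElliptic] [W.IsGloballyMinimal] (p : ℕ) [Fact p.Prime],
      W.analyticRank = 0 → 5 ≤ p → Addv W p → SubTprime W p → Surj W p → FouquetGenericAt p W →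
      FouquetEligibleAt p W →
      (∃ (G : WeierstrassCurve ℚ) (_ : G.IsElliptic) (_ : G.IsGloballyMinimal),
        GoodOrd G p ∧ Surj G p ∧ Ram G p ∧ IsCongruentModP p W G ∧ FouquetEligibleAt p G) →
      MissingPPartAt W p := by
  intro W _ _ p _ hr hp hadd _ hsurj hgen helig hseed
  obtain ⟨G, hGe, hGm, hord, hsurjG, hramG, hcong, heligG⟩ := hseed
  exact missingPPartAt_rankZero_of_fouquetOrdinaryCongruenceSigma hF hmod hGZK W G p hp hr hadd hsurj hgen helig hord
    hsurjG hramG hcong heligG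

end Summit.BirchSwinnertonDyer.BirchSwinnertonDyer.Theorems

end
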